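import Mathlib
import HarnessLib
import Literature.NumberTheory.GaloisRepresentations.GaloisRep
import Literature.NumberTheory.GaloisRepresentations.CompactImageCharpolyIntegral

/-!
# Stub `stub_residualDuality_of_conjDuality` (line `birth`, crux `ExplicitRamifiedFamily`, stmt-Langlands-16778)

The route's LEVER at the level of this crux, in trace form: **an exact duality read through a
residually trivial ring endomorphism of `ℚ̄_p` is a residual essential self-duality**.

Setting (what a conjugation-ramified coefficient prime delivers). Let `ρ : Γ_K → GL₃(ℚ̄_p)` be
continuous and suppose there are a character `ν : Γ_K → GL₁(ℚ̄_p)` and a ring endomorphism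
`s : ℚ̄_p →+* ℚ̄_p` with

* `s` RESIDUALLY TRIVIAL on the valuation ring: `‖s x − x‖ < 1` whenever `‖x‖ ≤ 1` (intended: `s` an
  element of the inertia subgroup of `Gal(ℚ̄_p/ℚ_p)` extending complex conjugation `c` of the CM
  coefficient field `E` along the completion `E_λ ⊂ ℚ̄_p` at a prime `λ` with `c(λ) = λ` and
  `c ≡ id (mod λ)` — a prime of `E⁺` ramified in `E/E⁺`; `E_λ/ℚ_p` is then totally ramified at the
  places the route uses, so `c|_{E_λ}` lifts into inertia);
* EXACT `s`-semilinear duality: `ν(σ) · tr ρ(σ⁻¹) = s(tr ρ(σ))` for all `σ` (intended: the unitary /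
  Poincaré duality `ρᶜ ≅ ρ^∨ ⊗ ν` of an `E`-rational compatible system, `ν = ε⁻²` on `H²`, read on
  Frobenius traces `a_v ∈ E` — `tr ρ_λ(Frob_v⁻¹) ν(Frob_v) = i_λ(c a_v) = s(i_λ a_v)` — and extended to
  all `σ` by Chebotarev density and continuity of `s`).

Then conjunct (D) of the crux holds: `‖tr ρ(σ) − ν(σ) tr ρ(σ⁻¹)‖ < 1` for every `σ`, i.e.
`ρ̄ˢˢ ≅ (ρ̄ˢˢ)^∨ ⊗ ν̄` by Brauer–Nesbitt (`p > 3`).  Proof: traces of a compact-image `p`-adic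
representation are integral (`‖tr ρ(σ)‖ ≤ 1`, from the accepted
`FramedRep.charpoly_coeff_mem_integer` and `tr = −(coefficient of Xⁿ⁻¹)`), so
`‖tr ρ(σ) − ν(σ) tr ρ(σ⁻¹)‖ = ‖tr ρ(σ) − s(tr ρ(σ))‖ < 1`.

References: Ash–Grayson–Green 1984, p. 434, remark (3) (the phenomenon on the automorphic side);
Clozel 1990 / Caraiani 2012 (unitarity `ρᶜ ≅ ρ^∨ ε^{1-n}` for `r_ι(π)`); van Geemen–Top 1994 §1 and
Ito–Koshikawa–Mieda 2018 Prop. 3.7 (the shape `T³ − b_p T² + p b̄_p T − p³`, i.e. `ρᶜ ≅ ρ^∨ ε⁻²`, for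
the surface motives).
-/

set_option linter.dupNamespace false -- `Summit.Langlands.Langlands` is the mandated namespace

noncomputable section

namespace Summit.Langlands.Langlands.Cruxes.ExplicitRamifiedFamily.Birth

open Literature.NumberTheory.GaloisRepresentations

/-- **Traces of a continuous `p`-adic Galois representation are integral**: `‖tr ρ(σ)‖ ≤ 1` for
`ρ : Γ_K → GL_n(ℚ̄_p)` (`Γ_K` compact; `tr = −coeff_{n−1}(charpoly)` and the accepted
`FramedRep.charpoly_coeff_mem_integer`). [cite: SerreAbelianLadic1968, Ch. I §2.3] -/
theorem norm_trace_le_one {p : ℕ} [Fact p.Prime] {K : Type*} [Field K] {n : ℕ}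
    (ρ : FramedGaloisRep K (PadicAlgCl p) n) (σ : Field.absoluteGaloisGroup K) :
    ‖(ρ σ).val.trace‖ ≤ 1 := by
  rcases Nat.eq_zero_or_pos n with rfl | hn
  · simp [Matrix.trace]
  · haveI : Nonempty (Fin n) := ⟨⟨0, hn⟩⟩
    haveI : CompactSpace (Field.absoluteGaloisGroup K) := absoluteGaloisGroup_compactSpace K
    have h := FramedRep.charpoly_coeff_mem_integer ρ σ (Fintype.card (Fin n) - 1)
    have htr : (ρ σ).val.trace = -(FramedRep.charpoly ρ σ).coeff (Fintype.card (Fin n) - 1) :=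
      Matrix.trace_eq_neg_charpoly_coeff _
    rw [htr, norm_neg]
    have h' : Valued.v ((FramedRep.charpoly ρ σ).coeff (Fintype.card (Fin n) - 1)) ≤ 1 := h
    rw [PadicAlgCl.valuation_def] at h'
    exact_mod_cast h'

/-- **STUB — residual essential self-duality (conjunct (D) of the crux) from an exact duality read
through a residually trivial ring endomorphism** (the route's lever at trace level; provable now,
S-sized).  For continuous `ρ : Γ_K → GL₃(ℚ̄_p)`, a character `ν` and `s : ℚ̄_p →+* ℚ̄_p` with
`‖s x − x‖ < 1` on `‖x‖ ≤ 1` and `ν(σ) tr ρ(σ⁻¹) = s(tr ρ(σ))` for all `σ`: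
`‖tr ρ(σ) − ν(σ) tr ρ(σ⁻¹)‖ < 1` for all `σ`.  Proof: integrality of traces (`norm_trace_le_one`)
and the hypothesis on `s`. [cite: AshGraysonGreen1984, p. 434, remark (3)]
[cite: ItoKoshikawaMieda2018, Prop. 3.7] -/
theorem stub_residualDuality_of_conjDuality :
    ∀ (p : ℕ) [Fact p.Prime] (K : Type) [Field K]
      (ρ : Literature.NumberTheory.GaloisRepresentations.FramedGaloisRep K (PadicAlgCl p) 3)
      (ν : Literature.NumberTheory.GaloisRepresentations.FramedGaloisRep K (PadicAlgCl p) 1)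
      (s : PadicAlgCl p →+* PadicAlgCl p),
      (∀ x : PadicAlgCl p, ‖x‖ ≤ 1 → ‖s x - x‖ < 1) →
      (∀ σ, (ν σ).val 0 0 * (ρ σ⁻¹).val.trace = s ((ρ σ).val.trace)) →
      ∀ σ, ‖(ρ σ).val.trace - (ν σ).val 0 0 * (ρ σ⁻¹).val.trace‖ < 1 := by
  intro p _ K _ ρ ν s hs hdual σ
  rw [hdual σ, norm_sub_rev]
  exact hs _ (norm_trace_le_one ρ σ)

end Summit.Langlands.Langlands.Cruxes.ExplicitRamifiedFamily.Birth

end
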